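import Summits.NavierStokesRegularity.NavierStokesRegularity.Theorems.EfficiencyFloorProductionEfficiencyDecayFrequentDepletion
import Summits.NavierStokesRegularity.NavierStokesRegularity.Theorems.EfficiencyFloorFloorOfEfficiencyDecay
import Summits.NavierStokesRegularity.NavierStokesRegularity.Theorems.StretchingWellBindingEnstrophyQuarterLawRegisteredStatus
import Summits.NavierStokesRegularity.NavierStokesRegularity.Theorems.HodographBetchovEquivalence
import Summits.NavierStokesRegularity.NavierStokesRegularity.Theorems.SoloInformedClayDichotomy
import HarnessLib

/-!
# Route `EfficiencyFloor`: its two cruxes `ProductionEfficiencyDecay` (stmt-NavierStokesRegularity-22866) and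
# `EnstrophyQuarterLaw` (stmt-NavierStokesRegularity-1574), and the four ACTIVE registered stubs of their lines,
# placed against the summit — each is a CONSEQUENCE of Clay (A), their conjunction IS Clay (A), and refuting any
# one of them proves Fefferman's breakdown statement (C)

Helper file (`--supports stmt-NavierStokesRegularity-22866 --as helper`; serves the shared residual stmt-1574 equally;
seat leafhand-ns-efficiencyfloor-4 g5). Genre: the by-name placement files `…L3TimeExponentPincerRouteEquivalence` and
`…ScaledTopAlignmentMostTimesSummitEquivalence`, which the tree did not yet have for THIS route. Pure logic over LANDED
theorems; no registered stub and no crux is closed; Navier–Stokes regularity is NOT proved.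

The objects. `PED` = `Theses.EfficiencyFloor.ProductionEfficiencyDecay` (22866, attacked conjunct); `EQL` =
`Theses.EfficiencyFloor.EnstrophyQuarterLaw` (the route's copy of the shared residual 1574, whose own decl is
`Theses.StretchingWellBinding.EnstrophyQuarterLaw` — same text); the registered crux-proper stub S2 =
`stub_depletionGivenBudget` of line `efficiency_floor` (skeleton 5ef94d9ef1bdda69; verbatim below); the three active
stubs of line `sparse_sieve` of 1574 (skeleton 3cd087f404dfff1e): `stub_uniformLocalTypeI`, `stub_uniformSparseness`
(registered signatures, in the importable vocabulary `EnstrophyQuarterLaw.SparseSieve.UniformLocalTypeI /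
UniformSparseness`) and `stub_noTypeII` = `Theses.TypeILiouville.TypeIliouvilleNoTypeII` (stmt-0056).

* §1 NECESSITY (ON PATH). `productionEfficiencyDecay_of_navierStokesRegularity`, `enstrophyQuarterLaw_of_…`,
  `enstrophyQuarterLaw_shared_of_…`, `depletionGivenBudget_of_…`, `typeIliouvilleNoTypeII_of_…`,
  `stub_uniformLocalTypeI_of_…`, `stub_uniformSparseness_of_…`: every one of these statements quantifies over maximal
  smooth Leray–Hopf rapidly-decaying-datum solutions of FINITE lifespan, and under Clay (A) there is none
  (`HodographBetchov.noBlowup_of_navierStokesRegularity`: Clay-class uniqueness, Tao 2013 Cor. 11.4, run through the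
  landed `blowup_assembly`) — so each holds by vacuity. Consequence: none of them is an OVER-ATTACK (none is refutable
  short of refuting (A)).
* §2 EQUIVALENCE. `navierStokesRegularity_iff_productionEfficiencyDecay_and_enstrophyQuarterLaw : (A) ↔ PED ∧ EQL`
  (`←` = the route's deciding theorem `Theses.EfficiencyFloor.closes` with its two PROVED supports
  `efficiencyFloor_floorOfEfficiencyDecay_proof` (22868) and `efficiencyFloor_blowupEnstrophyUnbounded_proof` (22867));
  hence given either crux the other IS the summit (`productionEfficiencyDecay_iff_navierStokesRegularity_of_…`,
  `enstrophyQuarterLaw_iff_navierStokesRegularity_of_…`); and, through the landed no-loss certificates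
  (`ProductionEfficiencyDecay.productionEfficiencyDecay_of_depletion` p585755,
  `EnstrophyQuarterLaw.SparseSieve.Registered.enstrophyQuarterLaw_iff_stubs`), THE FOUR ACTIVE STUBS OF THE TWO
  LEAVES ARE JOINTLY EQUIVALENT TO CLAY (A): `navierStokesRegularity_iff_activeStubs`.
* §3 KILL VALUE. `navierStokesBreakdownR3_of_not_…` for each crux and each active stub: a refutation of ANY of them
  refutes (A) and therefore, by the landed dichotomy `navierStokesRegularity_or_breakdownR3` ((A) ∨ (C)), PROVES the
  breakdown statement (C) (`Summit.….NavierStokesBreakdownR3`). In particular an inhabitant of either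
  `--negative-modulo` hypothesis of the crux's `Negative/` files (`LerayRateBlowup`, `DssLerayHopfBlowup`) is a
  (C)-witness (`navierStokesBreakdownR3_of_lerayRateBlowup`, `…_of_dssLerayHopfBlowup`), and both are excluded by (A).
* §4 THE TWO FACTORS OF THE CRUX ARE ON PATH. With the landed factorisation `PED ↔ ¬LerayRateBlowup ∧ U`
  (`FrequentDepletion.productionEfficiencyDecay_iff_not_lerayRate_and_upgrade`): (A) ⟹ ¬`LerayRateBlowup` and
  (A) ⟹ U (`upgrade_of_navierStokesRegularity`), so neither factor over-attacks either.

READING for the census instrument / directors (numbers, not adjectives): for leaf 22866 the only active stub S2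
satisfies `PED → S2` (p585755) and `(A) → S2` (here) and `S2 ∧ EQL → (A)` (here); for leaf 1574 the active stubs
satisfy `EQL ↔ 0056 ∧ ∀S1 ∧ ∀S2` (RegisteredStatus) and `(A) → each` (here) and `PED ∧ (0056 ∧ ∀S1 ∧ ∀S2) → (A)`
(here). So every active stub of both leaves is pinned between its crux and the summit: not closable short of its
crux, not refutable short of ¬(A).

HONEST FRAMING: implications/equivalences between OPEN statements and the summit; nothing here proves `PED`, `EQL`,
any stub, (A) or (C); no summit statement is proved. [folklore]
-/

-- the problem directory repeats the summit name (`NavierStokesRegularity/NavierStokesRegularity`)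
set_option linter.dupNamespace false

noncomputable section

open Set Filter MeasureTheory Topology
open scoped InnerProductSpace ENNReal NNReal
open Literature.Analysis.FluidPDE

namespace Summit.NavierStokesRegularity.NavierStokesRegularity.Theorems

namespace EfficiencyFloorSummitEquivalence

/-! ### §1 Necessity: the cruxes and the active stubs are consequences of Clay (A) -/

/-- **(A) ⟹ no blow-up in the route's frame**: under `NavierStokesRegularity` no classical solution of the unforced
system on `ℝ³ × [0,T)` (`ν, T > 0`) that is Leray–Hopf from a rapidly decaying datum is maximal at `T`
(re-export of `HodographBetchov.noBlowup_of_navierStokesRegularity`, Tao 2013 Cor. 11.4 via `blowup_assembly`).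
[cite: Tao2011, Cor. 11.4] -/
theorem not_isMaximalSmoothSolution_of_navierStokesRegularity (hA : _root_.NavierStokesRegularity) {ν T : ℝ}
    (hν : 0 < ν) (hT : 0 < T) {u : ℝ → EuclideanSpace ℝ (Fin 3) → EuclideanSpace ℝ (Fin 3)}
    {p : ℝ → EuclideanSpace ℝ (Fin 3) → ℝ} (hmax : IsMaximalSmoothSolution ν 0 u p T)
    (hLH : IsLerayHopfOn T ν 0 (u 0) u) (hdec : HasRapidSpatialDecay (u 0)) : False :=
  hmax.2 (HodographBetchov.noBlowup_of_navierStokesRegularity hA ν T hν hT u p hmax.1 hLH hdec)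

/-- **(A) ⟹ `ProductionEfficiencyDecay`** (crux stmt-22866, BY NAME): vacuous under Clay (A), which leaves no
maximal smooth Leray–Hopf rapidly-decaying-datum solution of finite lifespan. So the attacked conjunct of route
`EfficiencyFloor` is not an over-attack: it cannot be refuted without refuting (A). [folklore] -/
theorem productionEfficiencyDecay_of_navierStokesRegularity (hA : _root_.NavierStokesRegularity) :
    Theses.EfficiencyFloor.ProductionEfficiencyDecay := by
  intro ν T hν hT u p hmax hLH hdec
  exact (not_isMaximalSmoothSolution_of_navierStokesRegularity hA hν hT hmax hLH hdec).elim

/-- **(A) ⟹ `EnstrophyQuarterLaw`** (the route's copy of the residual stmt-1574, BY NAME): vacuous under (A).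
[folklore] -/
theorem enstrophyQuarterLaw_of_navierStokesRegularity (hA : _root_.NavierStokesRegularity) :
    Theses.EfficiencyFloor.EnstrophyQuarterLaw := by
  intro ν T hν hT u p hmax hLH hdec
  exact (not_isMaximalSmoothSolution_of_navierStokesRegularity hA hν hT hmax hLH hdec).elim

/-- **(A) ⟹ `StretchingWellBinding.EnstrophyQuarterLaw`** (the item's own decl of the shared residual stmt-1574,
BY NAME; same text as the route's copy). [folklore] -/
theorem enstrophyQuarterLaw_shared_of_navierStokesRegularity (hA : _root_.NavierStokesRegularity) :
    Theses.StretchingWellBinding.EnstrophyQuarterLaw := by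
  intro ν T hν hT u p hmax hLH hdec
  exact (not_isMaximalSmoothSolution_of_navierStokesRegularity hA hν hT hmax hLH hdec).elim

/-- The two tree copies of the quarter law (route `EfficiencyFloor`'s and the item's `StretchingWellBinding` decl)
are the same statement. [folklore] -/
theorem enstrophyQuarterLaw_iff_shared :
    Theses.EfficiencyFloor.EnstrophyQuarterLaw ↔ Theses.StretchingWellBinding.EnstrophyQuarterLaw :=
  Iff.rfl

/-- **(A) ⟹ the registered crux-proper stub S2 = `stub_depletionGivenBudget` of line `efficiency_floor`**
(signature verbatim): by the landed reduction `depletion_of_productionEfficiencyDecay` (crux ⟹ S2, p585755) from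
`productionEfficiencyDecay_of_navierStokesRegularity`. So the one ACTIVE stub of leaf 22866 is a consequence of the
summit. [folklore] -/
theorem depletionGivenBudget_of_navierStokesRegularity (hA : _root_.NavierStokesRegularity) :
    ∀ (c ν T : ℝ), 0 < c → 0 < ν → 0 < T → ∀ (u : ℝ → EuclideanSpace ℝ (Fin 3) → EuclideanSpace ℝ (Fin 3)) (p : ℝ → EuclideanSpace ℝ (Fin 3) → ℝ), Literature.Analysis.FluidPDE.IsMaximalSmoothSolution ν 0 u p T → Literature.Analysis.FluidPDE.IsLerayHopfOn T ν 0 (u 0) u → Literature.Analysis.FluidPDE.HasRapidSpatialDecay (u 0) → ∀ (Zr Pr Sr : ℝ → ℝ), (∀ t ∈ Set.Ioo 0 T, ∫⁻ x, ‖Literature.Analysis.FluidPDE.curl (u t) x‖ₑ ^ 2 = ENNReal.ofReal (Zr t) ∧ 0 ≤ Zr t ∧ 0 ≤ Pr t ∧ Pr t = ∫ x, Literature.Analysis.FluidPDE.frobeniusNormSq (fderiv ℝ (Literature.Analysis.FluidPDE.curl (u t)) x) ∧ Sr t = ∫ x, ⟪Literature.Analysis.FluidPDE.curl (u t) x, fderiv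 ℝ (u t) x (Literature.Analysis.FluidPDE.curl (u t) x)⟫_ℝ ∧ HasDerivAt Zr (2 * Sr t - 2 * ν * Pr t) t ∧ |Sr t| ≤ c * Zr t ^ (3/4 : ℝ) * Pr t ^ (3/4 : ℝ)) → ∀ ε : ℝ, 0 < ε → ∃ t₁ ∈ Set.Ioo 0 T, ∀ t ∈ Set.Ico t₁ T, 0 < Zr t ∧ 2 * Sr t - 2 * ν * Pr t ≤ ε * Zr t ^ 3 :=
  ProductionEfficiencyDecay.depletion_of_productionEfficiencyDecay
    (productionEfficiencyDecay_of_navierStokesRegularity hA)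

/-- **(A) ⟹ `TypeIliouvilleNoTypeII`** (stmt-0056 = the active stub `stub_noTypeII` of line `sparse_sieve` of
leaf 1574, BY NAME): vacuous under (A). [folklore] -/
theorem typeIliouvilleNoTypeII_of_navierStokesRegularity (hA : _root_.NavierStokesRegularity) :
    Theses.TypeILiouville.TypeIliouvilleNoTypeII := by
  intro ν T hν hT u p hmax hLH hdec
  exact (not_isMaximalSmoothSolution_of_navierStokesRegularity hA hν hT hmax hLH hdec).elim

/-- **(A) ⟹ the active stub `stub_uniformLocalTypeI` of line `sparse_sieve`** (registered signature, importable
vocabulary): vacuous under (A). [folklore] -/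
theorem stub_uniformLocalTypeI_of_navierStokesRegularity (hA : _root_.NavierStokesRegularity) :
    ∀ (ν T : ℝ), 0 < ν → 0 < T →
      ∀ (u : ℝ → EuclideanSpace ℝ (Fin 3) → EuclideanSpace ℝ (Fin 3))
        (p : ℝ → EuclideanSpace ℝ (Fin 3) → ℝ),
      IsMaximalSmoothSolution ν 0 u p T → IsLerayHopfOn T ν 0 (u 0) u →
      HasRapidSpatialDecay (u 0) → EnstrophyQuarterLaw.SparseSieve.UniformLocalTypeI T u := by
  intro ν T hν hT u p hmax hLH hdec
  exact (not_isMaximalSmoothSolution_of_navierStokesRegularity hA hν hT hmax hLH hdec).elim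

/-- **(A) ⟹ the active stub `stub_uniformSparseness` of line `sparse_sieve`** (registered signature, importable
vocabulary): vacuous under (A). [folklore] -/
theorem stub_uniformSparseness_of_navierStokesRegularity (hA : _root_.NavierStokesRegularity) :
    ∀ (ν T : ℝ), 0 < ν → 0 < T →
      ∀ (u : ℝ → EuclideanSpace ℝ (Fin 3) → EuclideanSpace ℝ (Fin 3))
        (p : ℝ → EuclideanSpace ℝ (Fin 3) → ℝ),
      IsMaximalSmoothSolution ν 0 u p T → IsLerayHopfOn T ν 0 (u 0) u →
      HasRapidSpatialDecay (u 0) → EnstrophyQuarterLaw.SparseSieve.UniformSparseness T u := by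
  intro ν T hν hT u p hmax hLH hdec
  exact (not_isMaximalSmoothSolution_of_navierStokesRegularity hA hν hT hmax hLH hdec).elim

/-! ### §2 Equivalence: the route is a lossless split of Clay (A), down to its active stubs -/

/-- **Sufficiency, with the proved supports discharged**: `PED → EQL → (A)` — the route's deciding theorem
`Theses.EfficiencyFloor.closes` fed with the LANDED supports `FloorOfEfficiencyDecay` (stmt-22868,
`efficiencyFloor_floorOfEfficiencyDecay_proof`) and `BlowupEnstrophyUnbounded` (stmt-22867,
`efficiencyFloor_blowupEnstrophyUnbounded_proof`). Conditional on the two OPEN cruxes. [folklore] -/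
theorem navierStokesRegularity_of_productionEfficiencyDecay_of_enstrophyQuarterLaw
    (hE : Theses.EfficiencyFloor.ProductionEfficiencyDecay) (hQ : Theses.EfficiencyFloor.EnstrophyQuarterLaw) :
    _root_.NavierStokesRegularity :=
  Theses.EfficiencyFloor.closes hE efficiencyFloor_floorOfEfficiencyDecay_proof
    efficiencyFloor_blowupEnstrophyUnbounded_proof hQ

/-- **`(A) ↔ PED ∧ EQL`**: route `EfficiencyFloor` is an EQUIVALENT reformulation of Clay (A) at the level of its two
cruxes (necessity §1, sufficiency = `closes` with proved supports). Neither side is asserted. [folklore] -/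
theorem navierStokesRegularity_iff_productionEfficiencyDecay_and_enstrophyQuarterLaw :
    _root_.NavierStokesRegularity ↔
      (Theses.EfficiencyFloor.ProductionEfficiencyDecay ∧ Theses.EfficiencyFloor.EnstrophyQuarterLaw) :=
  ⟨fun hA => ⟨productionEfficiencyDecay_of_navierStokesRegularity hA, enstrophyQuarterLaw_of_navierStokesRegularity hA⟩,
    fun h => navierStokesRegularity_of_productionEfficiencyDecay_of_enstrophyQuarterLaw h.1 h.2⟩

/-- The same split with the shared item's own decl `StretchingWellBinding.EnstrophyQuarterLaw` (stmt-1574).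
[folklore] -/
theorem navierStokesRegularity_iff_productionEfficiencyDecay_and_enstrophyQuarterLaw_shared :
    _root_.NavierStokesRegularity ↔
      (Theses.EfficiencyFloor.ProductionEfficiencyDecay ∧ Theses.StretchingWellBinding.EnstrophyQuarterLaw) :=
  navierStokesRegularity_iff_productionEfficiencyDecay_and_enstrophyQuarterLaw

/-- Given the residual, **the attacked crux IS the summit**: `EQL → (PED ↔ (A))`. [folklore] -/
theorem productionEfficiencyDecay_iff_navierStokesRegularity_of_enstrophyQuarterLaw
    (hQ : Theses.EfficiencyFloor.EnstrophyQuarterLaw) :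
    Theses.EfficiencyFloor.ProductionEfficiencyDecay ↔ _root_.NavierStokesRegularity :=
  ⟨fun hE => navierStokesRegularity_of_productionEfficiencyDecay_of_enstrophyQuarterLaw hE hQ,
    productionEfficiencyDecay_of_navierStokesRegularity⟩

/-- Given the attacked crux, **the residual IS the summit**: `PED → (EQL ↔ (A))`. [folklore] -/
theorem enstrophyQuarterLaw_iff_navierStokesRegularity_of_productionEfficiencyDecay
    (hE : Theses.EfficiencyFloor.ProductionEfficiencyDecay) :
    Theses.EfficiencyFloor.EnstrophyQuarterLaw ↔ _root_.NavierStokesRegularity :=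
  ⟨fun hQ => navierStokesRegularity_of_productionEfficiencyDecay_of_enstrophyQuarterLaw hE hQ,
    enstrophyQuarterLaw_of_navierStokesRegularity⟩

/-- **`(A) ↔ S2 ∧ EQL`**: the registered crux-proper stub `stub_depletionGivenBudget` of leaf 22866 (verbatim) is
summit-equivalent modulo the residual (`S2 → PED` is the landed skeleton composition
`productionEfficiencyDecay_of_depletion`, p585755). [folklore] -/
theorem navierStokesRegularity_iff_depletionGivenBudget_and_enstrophyQuarterLaw :
    _root_.NavierStokesRegularity ↔
      ((∀ (c ν T : ℝ), 0 < c → 0 < ν → 0 < T → ∀ (u : ℝ → EuclideanSpace ℝ (Fin 3) → EuclideanSpace ℝ (Fin 3)) (p : ℝ → EuclideanSpace ℝ (Fin 3) → ℝ), Literature.Analysis.FluidPDE.IsMaximalSmoothSolution ν 0 u p T → Literature.Analysis.FluidPDE.IsLerayHopfOn T ν 0 (u 0) u → Literature.Analysis.FluidPDE.HasRapidSpatialDecay (u 0) → ∀ (Zr Pr Sr : ℝ → ℝ), (∀ t ∈ Set.Ioo 0 T, ∫⁻ x, ‖Literature.Analysis.FluidPDE.curl (u t) x‖ₑ ^ 2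 = ENNReal.ofReal (Zr t) ∧ 0 ≤ Zr t ∧ 0 ≤ Pr t ∧ Pr t = ∫ x, Literature.Analysis.FluidPDE.frobeniusNormSq (fderiv ℝ (Literature.Analysis.FluidPDE.curl (u t)) x) ∧ Sr t = ∫ x, ⟪Literature.Analysis.FluidPDE.curl (u t) x, fderiv ℝ (u t) x (Literature.Analysis.FluidPDE.curl (u t) x)⟫_ℝ ∧ HasDerivAt Zr (2 * Sr t - 2 * ν * Pr t) t ∧ |Sr t| ≤ c * Zr t ^ (3/4 : ℝ) * Pr t ^ (3/4 : ℝ)) → ∀ ε : ℝ, 0 < ε → ∃ t₁ ∈ Set.Ioo 0 T, ∀ t ∈ Set.Ico t₁ T, 0 < Zr t ∧ 2 * Sr t - 2 * ν * Pr t ≤ ε * Zr t ^ 3) ∧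
        Theses.EfficiencyFloor.EnstrophyQuarterLaw) :=
  ⟨fun hA => ⟨depletionGivenBudget_of_navierStokesRegularity hA, enstrophyQuarterLaw_of_navierStokesRegularity hA⟩,
    fun h => navierStokesRegularity_of_productionEfficiencyDecay_of_enstrophyQuarterLaw
      (ProductionEfficiencyDecay.productionEfficiencyDecay_of_depletion h.1) h.2⟩

/-- **THE FOUR ACTIVE STUBS OF THE TWO LEAVES ARE JOINTLY EQUIVALENT TO CLAY (A):**
`(A) ↔ S2(22866) ∧ (stub_noTypeII ∧ ∀ stub_uniformLocalTypeI ∧ ∀ stub_uniformSparseness)(1574)`, all four in their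
registered signatures (`→` §1; `←` the two landed skeleton compositions `productionEfficiencyDecay_of_depletion`
(p585755) and `SparseSieve.Registered.enstrophyQuarterLaw_iff_stubs`, then `closes`). Each conjunct is OPEN; nothing
is asserted about any of them. [folklore] -/
theorem navierStokesRegularity_iff_activeStubs :
    _root_.NavierStokesRegularity ↔
      ((∀ (c ν T : ℝ), 0 < c → 0 < ν → 0 < T → ∀ (u : ℝ → EuclideanSpace ℝ (Fin 3) → EuclideanSpace ℝ (Fin 3)) (p : ℝ → EuclideanSpace ℝ (Fin 3) → ℝ), Literature.Analysis.FluidPDE.IsMaximalSmoothSolution ν 0 u p T → Literature.Analysis.FluidPDE.IsLerayHopfOn T ν 0 (u 0) u → Literature.Analysis.FluidPDE.HasRapidSpatialDecay (u 0) → ∀ (Zr Pr Sr : ℝ → ℝ), (∀ t ∈ Set.Ioo 0 T, ∫⁻ x, ‖Literature.Analysis.FluidPDE.curl (u t) x‖ₑ ^ 2 = ENNReal.ofReal (Zr t) ∧ 0 ≤ Zr t ∧ 0 ≤ Pr t ∧ Pr t = ∫ x, Literature.Analysis.FluidPDE.frobeniusNormSq (fderiv ℝ (Literature.Analysis.FluidPDE.curl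 (u t)) x) ∧ Sr t = ∫ x, ⟪Literature.Analysis.FluidPDE.curl (u t) x, fderiv ℝ (u t) x (Literature.Analysis.FluidPDE.curl (u t) x)⟫_ℝ ∧ HasDerivAt Zr (2 * Sr t - 2 * ν * Pr t) t ∧ |Sr t| ≤ c * Zr t ^ (3/4 : ℝ) * Pr t ^ (3/4 : ℝ)) → ∀ ε : ℝ, 0 < ε → ∃ t₁ ∈ Set.Ioo 0 T, ∀ t ∈ Set.Ico t₁ T, 0 < Zr t ∧ 2 * Sr t - 2 * ν * Pr t ≤ ε * Zr t ^ 3) ∧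
        (Theses.TypeILiouville.TypeIliouvilleNoTypeII ∧
          (∀ (ν T : ℝ), 0 < ν → 0 < T →
            ∀ (u : ℝ → EuclideanSpace ℝ (Fin 3) → EuclideanSpace ℝ (Fin 3))
              (p : ℝ → EuclideanSpace ℝ (Fin 3) → ℝ),
            IsMaximalSmoothSolution ν 0 u p T → IsLerayHopfOn T ν 0 (u 0) u →
            HasRapidSpatialDecay (u 0) → EnstrophyQuarterLaw.SparseSieve.UniformLocalTypeI T u) ∧
          (∀ (ν T : ℝ), 0 < ν → 0 < T →
            ∀ (u : ℝ → EuclideanSpace ℝ (Fin 3) → EuclideanSpace ℝ (Fin 3))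
              (p : ℝ → EuclideanSpace ℝ (Fin 3) → ℝ),
            IsMaximalSmoothSolution ν 0 u p T → IsLerayHopfOn T ν 0 (u 0) u →
            HasRapidSpatialDecay (u 0) → EnstrophyQuarterLaw.SparseSieve.UniformSparseness T u))) := by
  refine ⟨fun hA => ⟨depletionGivenBudget_of_navierStokesRegularity hA,
    typeIliouvilleNoTypeII_of_navierStokesRegularity hA, stub_uniformLocalTypeI_of_navierStokesRegularity hA,
    stub_uniformSparseness_of_navierStokesRegularity hA⟩, fun h => ?_⟩
  have hQ : Theses.StretchingWellBinding.EnstrophyQuarterLaw :=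
    EnstrophyQuarterLaw.SparseSieve.Registered.enstrophyQuarterLaw_iff_stubs.2 h.2
  exact navierStokesRegularity_of_productionEfficiencyDecay_of_enstrophyQuarterLaw
    (ProductionEfficiencyDecay.productionEfficiencyDecay_of_depletion h.1) hQ

/-! ### §3 Kill value: refuting a crux or an active stub proves Fefferman's (C) -/

/-- `¬ (A)` ⟹ **(C)**: the landed dichotomy `navierStokesRegularity_or_breakdownR3` ((A) ∨ (C), by the
`ν`-normalisation), resolved. [cite: FeffermanClay2006, (A) (C)] -/
theorem navierStokesBreakdownR3_of_not_navierStokesRegularity (h : ¬ _root_.NavierStokesRegularity) :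
    Summit.NavierStokesRegularity.NavierStokesRegularity.NavierStokesBreakdownR3 :=
  navierStokesRegularity_or_breakdownR3.resolve_left h

/-- **Refuting the attacked crux `ProductionEfficiencyDecay` (stmt-22866) proves (C).** [cite: FeffermanClay2006, (A) (C)] -/
theorem navierStokesBreakdownR3_of_not_productionEfficiencyDecay
    (h : ¬ Theses.EfficiencyFloor.ProductionEfficiencyDecay) :
    Summit.NavierStokesRegularity.NavierStokesRegularity.NavierStokesBreakdownR3 :=
  navierStokesBreakdownR3_of_not_navierStokesRegularity
    fun hA => h (productionEfficiencyDecay_of_navierStokesRegularity hA)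

/-- **Refuting the residual `EnstrophyQuarterLaw` (stmt-1574; e.g. exhibiting an enstrophy-Type-II blow-up) proves
(C).** [cite: FeffermanClay2006, (A) (C)] -/
theorem navierStokesBreakdownR3_of_not_enstrophyQuarterLaw
    (h : ¬ Theses.StretchingWellBinding.EnstrophyQuarterLaw) :
    Summit.NavierStokesRegularity.NavierStokesRegularity.NavierStokesBreakdownR3 :=
  navierStokesBreakdownR3_of_not_navierStokesRegularity
    fun hA => h (enstrophyQuarterLaw_shared_of_navierStokesRegularity hA)

/-- **Refuting the registered stub `stub_depletionGivenBudget` (a `stub-false` on leaf 22866) proves (C).**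
[cite: FeffermanClay2006, (A) (C)] -/
theorem navierStokesBreakdownR3_of_not_depletionGivenBudget
    (h : ¬ ∀ (c ν T : ℝ), 0 < c → 0 < ν → 0 < T → ∀ (u : ℝ → EuclideanSpace ℝ (Fin 3) → EuclideanSpace ℝ (Fin 3)) (p : ℝ → EuclideanSpace ℝ (Fin 3) → ℝ), Literature.Analysis.FluidPDE.IsMaximalSmoothSolution ν 0 u p T → Literature.Analysis.FluidPDE.IsLerayHopfOn T ν 0 (u 0) u → Literature.Analysis.FluidPDE.HasRapidSpatialDecay (u 0) → ∀ (Zr Pr Sr : ℝ → ℝ), (∀ t ∈ Set.Ioo 0 T, ∫⁻ x, ‖Literature.Analysis.FluidPDE.curl (u t) x‖ₑ ^ 2 = ENNReal.ofReal (Zr t) ∧ 0 ≤ Zr t ∧ 0 ≤ Pr t ∧ Pr t = ∫ x, Literature.Analysis.FluidPDE.frobeniusNormSq (fderiv ℝ (Literature.Analysis.FluidPDE.curl (u t)) x) ∧ Sr t = ∫ x, ⟪Literature.Analysis.FluidPDE.curl (u t) x, fderiv ℝ (u t) x (Literature.Analysis.FluidPDE.curl (u t) x)⟫_ℝ ∧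 HasDerivAt Zr (2 * Sr t - 2 * ν * Pr t) t ∧ |Sr t| ≤ c * Zr t ^ (3/4 : ℝ) * Pr t ^ (3/4 : ℝ)) → ∀ ε : ℝ, 0 < ε → ∃ t₁ ∈ Set.Ioo 0 T, ∀ t ∈ Set.Ico t₁ T, 0 < Zr t ∧ 2 * Sr t - 2 * ν * Pr t ≤ ε * Zr t ^ 3) :
    Summit.NavierStokesRegularity.NavierStokesRegularity.NavierStokesBreakdownR3 :=
  navierStokesBreakdownR3_of_not_navierStokesRegularity
    fun hA => h (depletionGivenBudget_of_navierStokesRegularity hA)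

/-- **Refuting `stub_noTypeII` = `TypeIliouvilleNoTypeII` (stmt-0056; e.g. exhibiting a velocity-Type-II
blow-up) proves (C).** [cite: FeffermanClay2006, (A) (C)] -/
theorem navierStokesBreakdownR3_of_not_typeIliouvilleNoTypeII
    (h : ¬ Theses.TypeILiouville.TypeIliouvilleNoTypeII) :
    Summit.NavierStokesRegularity.NavierStokesRegularity.NavierStokesBreakdownR3 :=
  navierStokesBreakdownR3_of_not_navierStokesRegularity
    fun hA => h (typeIliouvilleNoTypeII_of_navierStokesRegularity hA)

/-- **Refuting `stub_uniformLocalTypeI` (a `stub-false` on leaf 1574) proves (C).** [cite: FeffermanClay2006, (A) (C)] -/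
theorem navierStokesBreakdownR3_of_not_stub_uniformLocalTypeI
    (h : ¬ ∀ (ν T : ℝ), 0 < ν → 0 < T →
      ∀ (u : ℝ → EuclideanSpace ℝ (Fin 3) → EuclideanSpace ℝ (Fin 3))
        (p : ℝ → EuclideanSpace ℝ (Fin 3) → ℝ),
      IsMaximalSmoothSolution ν 0 u p T → IsLerayHopfOn T ν 0 (u 0) u →
      HasRapidSpatialDecay (u 0) → EnstrophyQuarterLaw.SparseSieve.UniformLocalTypeI T u) :
    Summit.NavierStokesRegularity.NavierStokesRegularity.NavierStokesBreakdownR3 :=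
  navierStokesBreakdownR3_of_not_navierStokesRegularity
    fun hA => h (stub_uniformLocalTypeI_of_navierStokesRegularity hA)

/-- **Refuting `stub_uniformSparseness` (a `stub-false` on leaf 1574) proves (C).** [cite: FeffermanClay2006, (A) (C)] -/
theorem navierStokesBreakdownR3_of_not_stub_uniformSparseness
    (h : ¬ ∀ (ν T : ℝ), 0 < ν → 0 < T →
      ∀ (u : ℝ → EuclideanSpace ℝ (Fin 3) → EuclideanSpace ℝ (Fin 3))
        (p : ℝ → EuclideanSpace ℝ (Fin 3) → ℝ),
      IsMaximalSmoothSolution ν 0 u p T → IsLerayHopfOn T ν 0 (u 0) u →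
      HasRapidSpatialDecay (u 0) → EnstrophyQuarterLaw.SparseSieve.UniformSparseness T u) :
    Summit.NavierStokesRegularity.NavierStokesRegularity.NavierStokesBreakdownR3 :=
  navierStokesBreakdownR3_of_not_navierStokesRegularity
    fun hA => h (stub_uniformSparseness_of_navierStokesRegularity hA)

/-- **An inhabitant of the `Negative/` hypothesis `LerayRateBlowup` is a (C)-witness** (it is a finite-time
singularity from a rapidly decaying datum; (A) excludes it, so the dichotomy gives (C)). [cite: FeffermanClay2006, (A) (C)] -/
theorem navierStokesBreakdownR3_of_lerayRateBlowup (hH : ProductionEfficiencyDecayNegative.LerayRateBlowup) :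
    Summit.NavierStokesRegularity.NavierStokesRegularity.NavierStokesBreakdownR3 :=
  navierStokesBreakdownR3_of_not_productionEfficiencyDecay
    (ProductionEfficiencyDecayNegative.ProductionEfficiencyDecay_false_of_LerayRateBlowup hH)

/-- **An inhabitant of the `Negative/` hypothesis `DssLerayHopfBlowup` is a (C)-witness** likewise.
[cite: FeffermanClay2006, (A) (C)] -/
theorem navierStokesBreakdownR3_of_dssLerayHopfBlowup (hH : ProductionEfficiencyDecayNegative.DssLerayHopfBlowup) :
    Summit.NavierStokesRegularity.NavierStokesRegularity.NavierStokesBreakdownR3 :=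
  navierStokesBreakdownR3_of_not_productionEfficiencyDecay
    (ProductionEfficiencyDecayNegative.ProductionEfficiencyDecay_false_of_DssLerayHopfBlowup hH)

/-! ### §4 The two factors of the crux (`PED ↔ ¬LerayRateBlowup ∧ U`) are on path -/

/-- **(A) ⟹ ¬`LerayRateBlowup`** (the first factor of the landed factorisation of the crux; an inhabitant would be
a maximal smooth Leray–Hopf rapidly-decaying-datum solution of finite lifespan). [folklore] -/
theorem not_lerayRateBlowup_of_navierStokesRegularity (hA : _root_.NavierStokesRegularity) :
    ¬ ProductionEfficiencyDecayNegative.LerayRateBlowup := by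
  rintro ⟨ν, T, u, p, hν, hT, hmax, hLH, hdec, -⟩
  exact not_isMaximalSmoothSolution_of_navierStokesRegularity hA hν hT hmax hLH hdec

/-- **(A) ⟹ ¬`DssLerayHopfBlowup`** (the BC5-rung hypothesis of the crux's `Negative/` file). [folklore] -/
theorem not_dssLerayHopfBlowup_of_navierStokesRegularity (hA : _root_.NavierStokesRegularity) :
    ¬ ProductionEfficiencyDecayNegative.DssLerayHopfBlowup := by
  rintro ⟨ν, T, u, p, hν, hT, hmax, hLH, hdec, -⟩
  exact not_isMaximalSmoothSolution_of_navierStokesRegularity hA hν hT hmax hLH hdec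

/-- **(A) ⟹ the UPGRADE statement U** ("frequently ⟹ eventually" for the pointwise efficiency law, the second
factor of `FrequentDepletion.productionEfficiencyDecay_iff_not_lerayRate_and_upgrade`, verbatim): vacuous under (A).
So neither factor of the crux is an over-attack. [folklore] -/
theorem upgrade_of_navierStokesRegularity (hA : _root_.NavierStokesRegularity) :
    ∀ (c ν T : ℝ), 0 < c → 0 < ν → 0 < T →
      ∀ (u : ℝ → EuclideanSpace ℝ (Fin 3) → EuclideanSpace ℝ (Fin 3))
        (p : ℝ → EuclideanSpace ℝ (Fin 3) → ℝ),
        Literature.Analysis.FluidPDE.IsMaximalSmoothSolution ν 0 u p T →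
        Literature.Analysis.FluidPDE.IsLerayHopfOn T ν 0 (u 0) u →
        Literature.Analysis.FluidPDE.HasRapidSpatialDecay (u 0) →
        ∀ (Zr Pr Sr : ℝ → ℝ), (∀ t ∈ Set.Ioo 0 T,
          ∫⁻ x, ‖Literature.Analysis.FluidPDE.curl (u t) x‖ₑ ^ 2 = ENNReal.ofReal (Zr t) ∧ 0 ≤ Zr t ∧
          0 ≤ Pr t ∧
          Pr t = ∫ x, Literature.Analysis.FluidPDE.frobeniusNormSq
            (fderiv ℝ (Literature.Analysis.FluidPDE.curl (u t)) x) ∧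
          Sr t = ∫ x, ⟪Literature.Analysis.FluidPDE.curl (u t) x,
            fderiv ℝ (u t) x (Literature.Analysis.FluidPDE.curl (u t) x)⟫_ℝ ∧
          HasDerivAt Zr (2 * Sr t - 2 * ν * Pr t) t ∧
          |Sr t| ≤ c * Zr t ^ (3 / 4 : ℝ) * Pr t ^ (3 / 4 : ℝ)) →
        ∀ ε : ℝ, 0 < ε →
          (∃ᶠ t in 𝓝[<] T, 0 < Zr t ∧ 2 * Sr t - 2 * ν * Pr t ≤ ε * Zr t ^ 3) →
          ∃ t₁ ∈ Set.Ioo 0 T, ∀ t ∈ Set.Ico t₁ T, 0 < Zr t ∧ 2 * Sr t - 2 * ν * Pr t ≤ ε * Zr t ^ 3 := by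
  intro c ν T hc hν hT u p hmax hLH hdec
  exact (not_isMaximalSmoothSolution_of_navierStokesRegularity hA hν hT hmax hLH hdec).elim

/-- **The factorisation run against the summit**: `(A) ↔ (¬LerayRateBlowup ∧ U) ∧ EQL` (the crux replaced by its
two landed factors). Equivalence of OPEN statements with the summit; nothing is asserted. [folklore] -/
theorem navierStokesRegularity_iff_factors_and_enstrophyQuarterLaw :
    _root_.NavierStokesRegularity ↔
      ((¬ ProductionEfficiencyDecayNegative.LerayRateBlowup ∧
        ∀ (c ν T : ℝ), 0 < c → 0 < ν → 0 < T →
          ∀ (u : ℝ → EuclideanSpace ℝ (Fin 3) → EuclideanSpace ℝ (Fin 3))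
            (p : ℝ → EuclideanSpace ℝ (Fin 3) → ℝ),
            Literature.Analysis.FluidPDE.IsMaximalSmoothSolution ν 0 u p T →
            Literature.Analysis.FluidPDE.IsLerayHopfOn T ν 0 (u 0) u →
            Literature.Analysis.FluidPDE.HasRapidSpatialDecay (u 0) →
            ∀ (Zr Pr Sr : ℝ → ℝ), (∀ t ∈ Set.Ioo 0 T,
              ∫⁻ x, ‖Literature.Analysis.FluidPDE.curl (u t) x‖ₑ ^ 2 = ENNReal.ofReal (Zr t) ∧ 0 ≤ Zr t ∧
              0 ≤ Pr t ∧
              Pr t = ∫ x, Literature.Analysis.FluidPDE.frobeniusNormSq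
                (fderiv ℝ (Literature.Analysis.FluidPDE.curl (u t)) x) ∧
              Sr t = ∫ x, ⟪Literature.Analysis.FluidPDE.curl (u t) x,
                fderiv ℝ (u t) x (Literature.Analysis.FluidPDE.curl (u t) x)⟫_ℝ ∧
              HasDerivAt Zr (2 * Sr t - 2 * ν * Pr t) t ∧
              |Sr t| ≤ c * Zr t ^ (3 / 4 : ℝ) * Pr t ^ (3 / 4 : ℝ)) →
            ∀ ε : ℝ, 0 < ε →
              (∃ᶠ t in 𝓝[<] T, 0 < Zr t ∧ 2 * Sr t - 2 * ν * Pr t ≤ ε * Zr t ^ 3) →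
              ∃ t₁ ∈ Set.Ioo 0 T, ∀ t ∈ Set.Ico t₁ T, 0 < Zr t ∧ 2 * Sr t - 2 * ν * Pr t ≤ ε * Zr t ^ 3) ∧
        Theses.EfficiencyFloor.EnstrophyQuarterLaw) := by
  rw [← ProductionEfficiencyDecay.FrequentDepletion.productionEfficiencyDecay_iff_not_lerayRate_and_upgrade]
  exact navierStokesRegularity_iff_productionEfficiencyDecay_and_enstrophyQuarterLaw

end EfficiencyFloorSummitEquivalence

end Summit.NavierStokesRegularity.NavierStokesRegularity.Theorems

end
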